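import Summits.BirchSwinnertonDyer.BirchSwinnertonDyer.Theorems.GenusKolyvaginAtTwoGenusPrimitiveSupplyAtTwoLegendreDoorHalf
import HarnessLib

/-!
# Route `GenusKolyvaginAtTwo`, crux #2 `GenusPrimitiveSupplyAtTwo` (stmt-BirchSwinnertonDyer-22136):
# THE CELL'S AN-24L `F1Sign2.SingleDoor.LegendreDoorCriterion` IS A THEOREM — the `←` half «`x − e` a square ⟹ `P ∈ 2W(𝔽_q)`»
# by an EXPLICIT HALVING INSIDE `𝔽_q` (no field extension), and `legendreDoorCriterion_holds`

Width seat `bsd-line-gk2-p4` g14 (cell `bsd-f1-sign2`); lane: the transposition door (sequel of `…LegendreDoorHalf`, gk2-p4 g13, which proved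
the certifying `→` half and `legendreDoorCriterion_of_converse`). THEOREMS ONLY (no definition, no named fact, no `sorry`); helper
`--supports stmt-BirchSwinnertonDyer-22136`; no item is closed; BSD is not proved by any of this.

WHAT. AN-24L (`F1Sign2/LegendreDoorCriterion.lean`, -an g8, typed by -ty; D-an-30 «proof open to any prover»; REF1 §61 THEOREM-GRADE): over
`ZMod q`, `q` odd, if the `2`-division cubic `ψ₂ = 4z³ + b₂z² + 2b₄z + b₆` has EXACTLY ONE root `e` and `P = (x, y) ∈ W(𝔽_q)` has
`2y + a₁x + a₃ ≠ 0`, then `(∃ R, 2R = P) ↔ IsSquare (x − e)`. This file proves the missing `←` half (`legendreDoorCriterion_mpr`) and assembles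
`legendreDoorCriterion_holds : LegendreDoorCriterion` and the primed (Legendre-symbol) form `legendreDoorCriterion'_holds`.

PROOF (in `𝔽_q` throughout; the paper route «2-isogeny descent, Silverman X.4.9» and the tree route «complete 2-descent over `𝔽_{q²}` +
Frobenius descent» are both avoided). Write `ψ₂(z) = 4(z − e)·g(z)`, `g(z) = z² + pz + r` (`4p = b₂ + 4e`, `4r = 2b₄ + b₂e + 4e²`, `b₆ = −4er`
from `ψ₂(e) = 0`). Uniqueness of the root makes `g` rootless in `𝔽_q` (a root `z ≠ e` of `g` is a second root of `ψ₂`; a root `z = e` forces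
`ψ₂ = 4(z − e)³`, i.e. `b₂ = −12e, b₄ = 6e², b₆ = −4e³`, whence `Δ = 0`), so `disc g = p² − 4r` is a NON-square. Put `𝐲 = 2y + a₁x + a₃ ≠ 0`,
`𝐲² = ψ₂(x)`; let `t² = x − e` (`t ≠ 0`), `m = 𝐲/(2t)` (`m² = g(x)`). The two numbers `c± = 2x + p ± 2m` have product `p² − 4r`, a non-square, so
ONE of them is a square `w²` (product of two non-squares is a square in `𝔽_q` — `legendreSym.mul`); replacing `m` by `−m` we may take
`w² = 2x + p + 2m`. Then with `u = x + tw + m`, `V = 2w(t² + tw + m)`: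
* `ψ₂(u) = 4(u − e)g(u) = V²` (`halving_psiTwo_eq_sq`), so `R = (u, v)`, `2v + a₁u + a₃ = V`, lies on `W`; `V ≠ 0` (`w = 0` would make `p² = 4r`,
  `t² + tw + m = 0` would make `g(e) = 0` — `root_of_halving_degenerate`);
* the duplication formula `x(2R)·ψ₂(u) = u⁴ − b₄u² − 2b₆u − b₈` (tree `EggDoubling.addX_self_mul_psiTwo`) and the polynomial identity
  `u⁴ − b₄u² − 2b₆u − b₈ = x·ψ₂(u)` (`halving_four_mul_dupNum`) give `x(2R) = x`, hence `2R = ±P` (Mathlib `Affine.Point.X_eq_iff`), and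
  `P = 2R` or `P = 2(−R)`.
Over `𝔽_q(√·)` this is the classical halving `x(R) = x + ρ₁ρ₂ + ρ₁ρ₃ + ρ₂ρ₃`, `ρ_i² = x − e_i` (Knapp, *Elliptic Curves*, Thm. 4.2), with
`ρ₁ = t`, `ρ₂ + ρ₃ = w`, `ρ₂ρ₃ = m`; the sign trick `c₊c₋ = disc g` is what keeps the computation rational. The three polynomial identities were
found and checked by a computer-algebra reduction modulo `{t² − (x − e), m² − g(x), w² − (2x + p + 2m)}` and are re-verified here by
`linear_combination`.

References: [Knapp1993] Thm. 4.2 (halving criterion and formula); [SilvermanAEC2009] III.2.3 (d) (duplication formula), Ex. X.4.8 / Prop. X.4.9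
(descent via two-isogeny); [Kramer1981] Prop. 3 (the door at a transposition prime).
-/

set_option linter.dupNamespace false -- tree convention: `Summit.BirchSwinnertonDyer.BirchSwinnertonDyer.Theorems` (summit = sub-problem)
set_option autoImplicit false

noncomputable section

open scoped Classical

namespace Summit.BirchSwinnertonDyer.BirchSwinnertonDyer.Theorems.GenusKolyTransp

open WeierstrassCurve
open Summit.BirchSwinnertonDyer.Rank1Residual.F1Sign2.EggDoubling (psiTwo dupNum sub_negY_sq_eq_psiTwo addX_self_mul_psiTwo)
open Summit.BirchSwinnertonDyer.Rank1Residual.F1Sign2.SingleDoor (LegendreDoorCriterion LegendreDoorCriterion'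
  legendreDoorCriterion_iff_primed)

/-! ## §17 Pure algebra of the halving point `u = x + tw + m` (any field) -/

section Algebra

variable {F : Type*} [Field F]

/-- **The halving point lies on the curve**: with `t² = x − e`, `m² = g(x) = x² + px + r`, `w² = 2x + p + 2m` and `u = x + tw + m`,
`4(u − e)·g(u) = (2w(t² + tw + m))²` — i.e. `ψ₂(u) = V²` once `ψ₂ = 4(z − e)g(z)`. Over `𝔽_q(√·)`: `u − e_i = (ρ_i + ρ_j)(ρ_i + ρ_k)`.
[cite: Knapp1993, Thm. 4.2] -/
theorem halving_psiTwo_eq_sq {e p r x t m w u : F} (ht : t ^ 2 = x - e) (hm : m ^ 2 = x ^ 2 + p * x + r)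
    (hw : w ^ 2 = 2 * x + p + 2 * m) (hu : u = x + t * w + m) :
    4 * (u - e) * (u ^ 2 + p * u + r) = (2 * w * (t ^ 2 + t * w + m)) ^ 2 := by
  subst hu
  linear_combination ((4 : F) * e * p + (8 : F) * e * x + (8 : F) * e * m + (-4 : F) * e * w ^ 2 + (-4 : F) * p * x
    + (4 : F) * p * w ^ 2 + (-8 : F) * x ^ 2 + (-8 : F) * x * m + (12 : F) * x * w ^ 2 + (-4 : F) * t ^ 2 * w ^ 2 + (-4 : F) * t * w ^ 3
    + (4 : F) * m * w ^ 2 + (-4 : F) * w ^ 4) * ht + ((4 : F) * e + (4 : F) * p + (4 : F) * x + (-4 : F) * t * w + (4 : F) * m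
    + (-4 : F) * w ^ 2) * hm + ((4 : F) * e ^ 2 + (-8 : F) * e * x + (4 : F) * e * t ^ 2 + (4 : F) * e * t * w + (4 : F) * e * m
    + (4 : F) * e * w ^ 2 + (-4 : F) * p * x + (-4 : F) * r + (-4 : F) * x * t ^ 2 + (-4 : F) * x * t * w + (-4 : F) * x * m
    + (-4 : F) * x * w ^ 2 + (-8 : F) * t * m * w) * hw

/-- **The double of the halving point has `X`-coordinate `x`** (numerator form): with the `b`-invariants of a curve whose `2`-division cubic is
`4(z − e)(z² + pz + r)` (`b₂ = 4(p − e)`, `b₄ = 2(r − ep)`, `b₆ = −4er`, `4b₈ = b₂b₆ − b₄²`) and `u = x + tw + m` as above,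
`4·(u⁴ − b₄u² − 2b₆u − b₈) = 4·x·(4u³ + b₂u² + 2b₄u + b₆)`, i.e. `dupNum(u) = x·ψ₂(u)`. [cite: SilvermanAEC2009, III.2.3 (d)] [cite: Knapp1993, Thm. 4.2] -/
theorem halving_four_mul_dupNum {e p r x t m w u b₂ b₄ b₆ b₈ : F} (ht : t ^ 2 = x - e) (hm : m ^ 2 = x ^ 2 + p * x + r)
    (hw : w ^ 2 = 2 * x + p + 2 * m) (hu : u = x + t * w + m) (hb₂ : b₂ = 4 * (p - e)) (hb₄ : b₄ = 2 * (r - e * p))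
    (hb₆ : b₆ = -4 * e * r) (hb₈ : 4 * b₈ = b₂ * b₆ - b₄ ^ 2) :
    4 * (u ^ 4 - b₄ * u ^ 2 - 2 * b₆ * u - b₈) = 4 * (x * (4 * u ^ 3 + b₂ * u ^ 2 + 2 * b₄ * u + b₆)) := by
  subst hu hb₂ hb₄ hb₆
  linear_combination (-1 : F) * hb₈ + ((4 : F) * e * p * w ^ 2 + (8 : F) * e * x * w ^ 2 + (-8 : F) * e * m * w ^ 2
    + (-12 : F) * p * x * w ^ 2 + (-8 : F) * r * w ^ 2 + (-16 : F) * x ^ 2 * w ^ 2 + (8 : F) * x * m * w ^ 2 + (4 : F) * t ^ 2 * w ^ 4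
    + (16 : F) * t * m * w ^ 3 + (24 : F) * m ^ 2 * w ^ 2) * ht + ((16 : F) * e ^ 2 + (8 : F) * e * p + (-16 : F) * e * x
    + (-32 : F) * e * t * w + (-24 : F) * e * w ^ 2 + (-12 : F) * p * x + (-4 : F) * r + (-4 : F) * x ^ 2 + (32 : F) * x * t * w
    + (24 : F) * x * w ^ 2 + (16 : F) * t * m * w + (4 : F) * m ^ 2) * hm + ((-4 : F) * e ^ 2 * p + (-8 : F) * e ^ 2 * x
    + (8 : F) * e ^ 2 * m + (-8 : F) * e * p * x + (-16 : F) * e * r + (-16 : F) * e * x * m + (-4 : F) * e * t ^ 2 * w ^ 2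
    + (-16 : F) * e * t * m * w + (12 : F) * p * x ^ 2 + (16 : F) * r * x + (8 : F) * x ^ 3 + (8 : F) * x ^ 2 * m
    + (4 : F) * x * t ^ 2 * w ^ 2 + (16 : F) * x * t * m * w) * hw

/-- **The degenerate case** `t² + tw + m = 0` (which would make the halving point `2`-torsion) forces `g(e) = e² + pe + r = 0`
(over `𝔽_q(√·)`: `t² + tw + m = (t + ρ₂)(t + ρ₃) = 0` gives `e = e₂` or `e = e₃`). [cite: Knapp1993, Thm. 4.2] -/
theorem root_of_halving_degenerate {e p r x t m w : F} (ht : t ^ 2 = x - e) (hm : m ^ 2 = x ^ 2 + p * x + r)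
    (hw : w ^ 2 = 2 * x + p + 2 * m) (hcase : t ^ 2 + t * w + m = 0) : e ^ 2 + p * e + r = 0 := by
  linear_combination (-1 : F) * hm + (x - e - t * w + m) * hcase + (e - x + t * w - m + w ^ 2) * ht + (x - e) * hw

end Algebra

/-! ## §18 Squares in `𝔽_q` -/

/-- **A product of two non-squares of `𝔽_q` is a square**, in the form used here: if `ab` is a non-square then `a` or `b` is a square
(`legendreSym.mul` + `legendreSym.eq_neg_one_iff` / `eq_one_iff`). [folklore] -/
theorem isSquare_or_isSquare_of_not_isSquare_mul (q : ℕ) [Fact q.Prime] {a b : ZMod q} (hab : ¬ IsSquare (a * b)) :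
    IsSquare a ∨ IsSquare b := by
  by_contra hcon
  obtain ⟨ha, hb⟩ := not_or.mp hcon
  have hca : ((a.val : ℤ) : ZMod q) = a := by simp
  have hcb : ((b.val : ℤ) : ZMod q) = b := by simp
  have la : legendreSym q a.val = -1 := (legendreSym.eq_neg_one_iff q).mpr (by rw [hca]; exact ha)
  have lb : legendreSym q b.val = -1 := (legendreSym.eq_neg_one_iff q).mpr (by rw [hcb]; exact hb)
  have hcast : (((a.val : ℤ) * (b.val : ℤ) : ℤ) : ZMod q) = a * b := by rw [Int.cast_mul, hca, hcb]
  have hab0 : (((a.val : ℤ) * (b.val : ℤ) : ℤ) : ZMod q) ≠ 0 := by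
    rw [hcast]
    intro h0
    apply hab
    rw [h0]
    exact IsSquare.zero
  have lab : legendreSym q ((a.val : ℤ) * (b.val : ℤ)) = 1 := by
    rw [legendreSym.mul, la, lb]; norm_num
  have hsq := (legendreSym.eq_one_iff q hab0).mp lab
  rw [hcast] at hsq
  exact hab hsq

/-! ## §19 The halving inside `𝔽_q` -/

/-- **Core of the `←` half**: for an elliptic `W/𝔽_q` (`q` odd) whose `2`-division cubic is `4(z − e)(z² + pz + r)` with `z² + pz + r`
ROOTLESS in `𝔽_q` and of non-square discriminant, a point `P = (x, y)`, and `t, m, w ∈ 𝔽_q` with `t² = x − e`, `m² = x² + px + r`,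
`w² = 2x + p + 2m`: the point `R = (x + tw + m, v)`, `2v + a₁(x + tw + m) + a₃ = 2w(t² + tw + m)`, lies in `W(𝔽_q)` and `2R = ±P`, so
`P ∈ 2W(𝔽_q)`. [cite: Knapp1993, Thm. 4.2] [cite: SilvermanAEC2009, III.2.3 (d) and Prop. X.4.9] -/
theorem exists_two_smul_eq_of_halving_data (q : ℕ) [Fact q.Prime] (hq : q ≠ 2) (W : WeierstrassCurve (ZMod q)) [W.IsElliptic]
    {e p r : ZMod q} (hb₂ : W.b₂ = 4 * (p - e)) (hb₄ : W.b₄ = 2 * (r - e * p)) (hb₆ : W.b₆ = -4 * e * r)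
    (hg : ∀ z : ZMod q, z ^ 2 + p * z + r ≠ 0) (hdisc : ¬ IsSquare (p ^ 2 - 4 * r))
    {x y : ZMod q} (h : W.toAffine.Nonsingular x y) {t m w : ZMod q}
    (ht : t ^ 2 = x - e) (hm : m ^ 2 = x ^ 2 + p * x + r) (hw : w ^ 2 = 2 * x + p + 2 * m) :
    ∃ R : W.toAffine.Point, 2 • R = .some x y h := by
  have h2 : (2 : ZMod q) ≠ 0 := by
    have : ((2 : ℕ) : ZMod q) ≠ 0 := by
      rw [Ne, ZMod.natCast_eq_zero_iff]
      intro hdvd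
      exact hq ((Nat.prime_dvd_prime_iff_eq (Fact.out) Nat.prime_two).mp hdvd)
    exact_mod_cast this
  have h4 : (4 : ZMod q) ≠ 0 := by
    rw [show (4 : ZMod q) = 2 * 2 by norm_num]; exact mul_ne_zero h2 h2
  have hpsi : ∀ z : ZMod q, psiTwo W z = 4 * (z - e) * (z ^ 2 + p * z + r) := by
    intro z; rw [psiTwo, hb₂, hb₄, hb₆]; ring
  -- the halving point
  obtain ⟨u, hu⟩ : ∃ u : ZMod q, u = x + t * w + m := ⟨_, rfl⟩
  obtain ⟨V, hV⟩ : ∃ V : ZMod q, V = 2 * w * (t ^ 2 + t * w + m) := ⟨_, rfl⟩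
  have hψu : psiTwo W u = V ^ 2 := by
    rw [hpsi u, hV]; exact halving_psiTwo_eq_sq ht hm hw hu
  have hV0 : V ≠ 0 := by
    intro hV0
    rw [hV] at hV0
    rcases mul_eq_zero.mp hV0 with h2w | hcase
    · have hw0 : w = 0 := (mul_eq_zero.mp h2w).resolve_left h2
      apply hdisc
      refine ⟨0, ?_⟩
      linear_combination (4 : ZMod q) * hm - (2 * x + p - 2 * m) * hw + ((2 * x + p - 2 * m) * w) * hw0
    · exact hg e (root_of_halving_degenerate ht hm hw hcase)
  obtain ⟨v, hv⟩ : ∃ v : ZMod q, 2 * v + W.a₁ * u + W.a₃ = V :=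
    ⟨(V - W.a₁ * u - W.a₃) / 2, by field_simp; ring⟩
  -- `R = (u, v)` lies on `W`
  have hequv : W.toAffine.Equation u v := by
    rw [Affine.equation_iff]
    have key : (2 * v + W.a₁ * u + W.a₃) ^ 2 = psiTwo W u := by rw [hv, hψu]
    rw [psiTwo, WeierstrassCurve.b₂, WeierstrassCurve.b₄, WeierstrassCurve.b₆] at key
    have e4 : (4 : ZMod q) * (v ^ 2 + W.a₁ * u * v + W.a₃ * v) = 4 * (u ^ 3 + W.a₂ * u ^ 2 + W.a₄ * u + W.a₆) := by
      linear_combination key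
    exact mul_left_cancel₀ h4 e4
  have hnsuv : W.toAffine.Nonsingular u v := W.toAffine.equation_iff_nonsingular.mp hequv
  have hvne : v ≠ W.toAffine.negY u v := by
    intro hveq
    apply hV0
    rw [← hv]
    have h0 : v - W.toAffine.negY u v = 0 := sub_eq_zero.mpr hveq
    rw [Affine.negY] at h0
    linear_combination h0
  -- the double of `R` has `X`-coordinate `x`
  have hX : W.toAffine.addX u u (W.toAffine.slope u u v v) = x := by
    have hmul := addX_self_mul_psiTwo W hequv hvne
    have hdup : dupNum W u = x * psiTwo W u := by
      have e4 := halving_four_mul_dupNum ht hm hw hu hb₂ hb₄ hb₆ W.b_relation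
      rw [dupNum, psiTwo]
      exact mul_left_cancel₀ h4 e4
    rw [hdup, hψu] at hmul
    exact mul_right_cancel₀ (pow_ne_zero 2 hV0) hmul
  -- hence `2R = ±P`
  have hnsD := Affine.nonsingular_add hnsuv hnsuv (fun hxy => hvne hxy.right)
  rcases (Affine.Point.X_eq_iff (h₁ := hnsD) (h₂ := h)).mp hX with hpos | hneg
  · exact ⟨.some u v hnsuv, by rw [two_nsmul, Affine.Point.add_self_of_Y_ne hvne]; exact hpos⟩
  · refine ⟨-(.some u v hnsuv), ?_⟩
    rw [two_nsmul, ← neg_add, Affine.Point.add_self_of_Y_ne hvne]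
    exact (congrArg Neg.neg hneg).trans (neg_neg _)

/-- **AN-24L, the `←` half** (in the binders of `F1Sign2.SingleDoor.LegendreDoorCriterion`): over `ZMod q`, `q` odd, if the `2`-division
cubic has exactly one root `e` and `P = (x, y)` with `2y + a₁x + a₃ ≠ 0` has `x − e` a square, then `P ∈ 2W(𝔽_q)`. Reduction to
`exists_two_smul_eq_of_halving_data`: `g = z² + pz + r` is rootless (uniqueness of the root + `Δ ≠ 0` for the triple-root case) with
non-square discriminant, `t² = x − e` has `t ≠ 0`, `m = 𝐲/(2t)`, and the sign of `m` is chosen so that `2x + p + 2m` is a square.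
[cite: SilvermanAEC2009, Ex. X.4.8 and Prop. X.4.9] [cite: Knapp1993, Thm. 4.2] -/
theorem legendreDoorCriterion_mpr (q : ℕ) [Fact q.Prime] (hq : q ≠ 2) (W : WeierstrassCurve (ZMod q)) [W.IsElliptic] (e : ZMod q)
    (he : ∀ z : ZMod q, 4 * z ^ 3 + W.b₂ * z ^ 2 + 2 * W.b₄ * z + W.b₆ = 0 ↔ z = e)
    (x y : ZMod q) (h : W.toAffine.Nonsingular x y) (hP : 2 * y + W.a₁ * x + W.a₃ ≠ 0) (hsq : IsSquare (x - e)) :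
    ∃ R : W.toAffine.Point, 2 • R = Affine.Point.some x y h := by
  have h2 : (2 : ZMod q) ≠ 0 := by
    have : ((2 : ℕ) : ZMod q) ≠ 0 := by
      rw [Ne, ZMod.natCast_eq_zero_iff]
      intro hdvd
      exact hq ((Nat.prime_dvd_prime_iff_eq (Fact.out) Nat.prime_two).mp hdvd)
    exact_mod_cast this
  have h4 : (4 : ZMod q) ≠ 0 := by
    rw [show (4 : ZMod q) = 2 * 2 by norm_num]; exact mul_ne_zero h2 h2
  -- `ψ₂ = 4(z − e)(z² + pz + r)`
  have he0 : psiTwo W e = 0 := (he e).mpr rfl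
  obtain ⟨p, hp⟩ : ∃ p : ZMod q, 4 * p = W.b₂ + 4 * e := ⟨(W.b₂ + 4 * e) / 4, mul_div_cancel₀ _ h4⟩
  obtain ⟨r, hr⟩ : ∃ r : ZMod q, 4 * r = 2 * W.b₄ + W.b₂ * e + 4 * e ^ 2 :=
    ⟨(2 * W.b₄ + W.b₂ * e + 4 * e ^ 2) / 4, mul_div_cancel₀ _ h4⟩
  have hb₂ : W.b₂ = 4 * (p - e) := by linear_combination -hp
  have hb₄ : W.b₄ = 2 * (r - e * p) := by
    refine mul_left_cancel₀ h4 ?_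
    linear_combination -(2 : ZMod q) * hr + 2 * e * hp
  have hb₆ : W.b₆ = -4 * e * r := by
    rw [psiTwo] at he0
    linear_combination he0 + e * hr
  have hpsi : ∀ z : ZMod q, psiTwo W z = 4 * (z - e) * (z ^ 2 + p * z + r) := by
    intro z; rw [psiTwo, hb₂, hb₄, hb₆]; ring
  -- `g` is rootless
  have hg : ∀ z : ZMod q, z ^ 2 + p * z + r ≠ 0 := by
    intro z hz
    have hz' : z = e := (he z).mp (by
      have hh := hpsi z; rw [psiTwo] at hh; rw [hh, hz]; ring)
    rw [hz'] at hz
    have hz2 : (-p - e) ^ 2 + p * (-p - e) + r = 0 := by linear_combination hz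
    have he' : -p - e = e := (he (-p - e)).mp (by
      have hh := hpsi (-p - e); rw [psiTwo] at hh; rw [hh, hz2]; ring)
    have hp2 : p = -2 * e := by linear_combination -he'
    have hr2 : r = e ^ 2 := by linear_combination hz - e * hp2
    have hB2 : W.b₂ = -12 * e := by rw [hb₂, hp2]; ring
    have hB4 : W.b₄ = 6 * e ^ 2 := by rw [hb₄, hr2, hp2]; ring
    have hB6 : W.b₆ = -4 * e ^ 3 := by rw [hb₆, hr2]; ring
    have hΔ : (4 : ZMod q) * W.Δ = 0 := by
      have hb8 := W.b_relation
      rw [WeierstrassCurve.Δ]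
      rw [hB2, hB4, hB6] at hb8 ⊢
      linear_combination (-144 * e ^ 2) * hb8
    exact W.isUnit_Δ.ne_zero ((mul_eq_zero.mp hΔ).resolve_left h4)
  -- `disc g` is a non-square
  have hdisc : ¬ IsSquare (p ^ 2 - 4 * r) := by
    rintro ⟨s, hs⟩
    obtain ⟨z₀, hz₀⟩ : ∃ z₀ : ZMod q, 2 * z₀ = s - p := ⟨(s - p) / 2, mul_div_cancel₀ _ h2⟩
    apply hg z₀
    refine mul_left_cancel₀ h4 ?_
    linear_combination (2 * z₀ + s + p) * hz₀ - hs
  -- `t`, `m`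
  obtain ⟨t, ht'⟩ := hsq
  have ht : t ^ 2 = x - e := by rw [ht']; ring
  have hY2 : (2 * y + W.a₁ * x + W.a₃) ^ 2 = psiTwo W x := by
    have hh := sub_negY_sq_eq_psiTwo W h.1
    rw [Affine.negY] at hh
    linear_combination hh
  have ht0 : t ≠ 0 := by
    rintro rfl
    apply hP
    have hxe : x = e := by linear_combination -ht
    rw [hxe, he0] at hY2
    rw [hxe]
    exact (pow_eq_zero_iff (n := 2) (by norm_num)).mp hY2
  obtain ⟨m, hm'⟩ : ∃ m : ZMod q, 2 * t * m = 2 * y + W.a₁ * x + W.a₃ :=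
    ⟨(2 * y + W.a₁ * x + W.a₃) / (2 * t), mul_div_cancel₀ _ (mul_ne_zero h2 ht0)⟩
  have hm : m ^ 2 = x ^ 2 + p * x + r := by
    have e1 : (2 * t) ^ 2 * m ^ 2 = (2 * t) ^ 2 * (x ^ 2 + p * x + r) := by
      have hh := hY2
      rw [← hm', hpsi x] at hh
      linear_combination hh - 4 * (x ^ 2 + p * x + r) * ht
    exact mul_left_cancel₀ (pow_ne_zero 2 (mul_ne_zero h2 ht0)) e1
  -- the sign of `m`
  have hprod : (2 * x + p + 2 * m) * (2 * x + p + 2 * (-m)) = p ^ 2 - 4 * r := by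
    linear_combination (-4 : ZMod q) * hm
  have hprod' : ¬ IsSquare ((2 * x + p + 2 * m) * (2 * x + p + 2 * (-m))) := by rwa [hprod]
  rcases isSquare_or_isSquare_of_not_isSquare_mul q hprod' with ⟨w, hw'⟩ | ⟨w, hw'⟩
  · exact exists_two_smul_eq_of_halving_data q hq W hb₂ hb₄ hb₆ hg hdisc h ht hm
      (show w ^ 2 = 2 * x + p + 2 * m by rw [hw']; ring)
  · have hm2 : (-m) ^ 2 = x ^ 2 + p * x + r := by rw [neg_sq]; exact hm
    exact exists_two_smul_eq_of_halving_data q hq W hb₂ hb₄ hb₆ hg hdisc h ht hm2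
      (show w ^ 2 = 2 * x + p + 2 * (-m) by rw [hw']; ring)

/-! ## §20 AN-24L BY NAME -/

/-- **AN-24L `F1Sign2.SingleDoor.LegendreDoorCriterion` HOLDS**: over `ZMod q`, `q` odd, for an elliptic `W` whose `2`-division cubic has
exactly one root `e` and `P = (x, y) ∈ W(𝔽_q)` with `2y + a₁x + a₃ ≠ 0`: `P ∈ 2W(𝔽_q) ↔ IsSquare (x − e)`. (`→`: `legendreDoorCriterion_mp`,
gk2-p4 g13; `←`: `legendreDoorCriterion_mpr` above.) The cell's door bit at a transposition prime is a Legendre symbol (MEMO-an v1.18.1).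
[cite: SilvermanAEC2009, Ex. X.4.8 and Prop. X.4.9] [cite: Knapp1993, Thm. 4.2] [cite: Kramer1981, Prop. 3] -/
theorem legendreDoorCriterion_holds : LegendreDoorCriterion :=
  legendreDoorCriterion_of_converse fun q _ hq W _ e he x y h hP hsq ↦ legendreDoorCriterion_mpr q hq W e he x y h hP hsq

/-- **AN-24L, primed form, HOLDS**: door OPEN at `q` (`P ∉ 2W(𝔽_q)`) iff `legendreSym q (x − e) = −1`. [cite: SilvermanAEC2009, Prop. X.4.9] -/
theorem legendreDoorCriterion'_holds : LegendreDoorCriterion' :=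
  legendreDoorCriterion_iff_primed.mp legendreDoorCriterion_holds

end Summit.BirchSwinnertonDyer.BirchSwinnertonDyer.Theorems.GenusKolyTransp

end
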